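import Summits.KontsevichZagierPeriods.Zeta5Search.Certificates.RecordRayDenominatorsBricksD16
import Summits.KontsevichZagierPeriods.Zeta5Search.Certificates.RecordRayStepTailTable
import HarnessLib

/-!
# ζ(5) search — the record ray's DENOMINATORS, XIII-c: the D16 class-law atlas WITH THE UNIFORM BRICK TAIL — exponent `0.8603` (p3 g7)

HONEST FRAMING: systematic search; no irrationality claim unless certified.

OUR work (Summit side; prover seat p3, generation 7).  The table `bwinsD16` of file XII-D16 (p3 g6: 3900 windows on `θ > 1/16`,
202 class-law windows by name, `λ = 381.5232 − 330.7611 = 50.7621`, `record_exponent_bricksD16`: `γ ≤ 0.8583`) combined with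
the uniform brick tail of file XIII (`BrickTail.tailFactor`: Zudilin's (8.11) brick exponent on fam-denom's 245 `ν`-cells at every
shift `m ≥ 16`, rate `≥ 0.3046` nats/step; census g37 REC-BRICKS-LEDGER §2 'kernel + T-port' column `50.4573 / 0.8603`):
`λ = 50.7621 − 0.3046 = 50.4575`, and

* `record_exponent_bricksD16_tail` — **hypothesis-free: for every `0 ≤ γ ≤ 0.8603`, eventually `|ζ(5) − P_n/Q(a·n)| < 1/q_n^γ`**
  with the integers `p_n = MLT·P_n`, `q_n = MLT·|Q(a·n)|` (`MLT = ML bwinsD16 n / tailFactor n`; ladder 0.8439 → 0.8533 → 0.8583 →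
  0.8603; Brown–Zudilin's print 0.86597 rests on the observed laws (28)–(30); census by-name ceiling ≈ 0.863).

No irrationality content (`γ < 1`).
-/

noncomputable section

open Filter Topology

namespace Summit.KontsevichZagierPeriods.Zeta5Search.RecordRay.BrickAtlas

open Literature.NumberTheory.Transcendental (zetaValue)

/-- **THE EXPONENT `0.8603`, hypothesis-free** (`λ = 50.7621 − 0.3046 = 50.4575`;
`0.8603·(50.4575 + 0.02 + 85.08768884) < 85.08768883 + 31.5452`).  For every `0 ≤ γ ≤ 0.8603`, eventually
`|ζ(5) − P_n/Q(a·n)| < 1/q_n^γ` with the integers `p_n = MLT bwinsD16 n·P_n`, `q_n = MLT bwinsD16 n·|Q(a·n)| ≥ 1`.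
No irrationality content (`γ < 1`). -/
theorem record_exponent_bricksD16_tail {γ : ℝ} (hγ0 : 0 ≤ γ) (hγ : γ ≤ 8603 / 10000) :
    ∀ᶠ n : ℕ in atTop, ∃ p : ℤ, ∃ q : ℕ, 1 ≤ q ∧ (q : ℚ) = MLT bwinsD16 n * |(recordQ n : ℚ)| ∧
      (p : ℚ) = MLT bwinsD16 n * recordP n ∧ |zetaValue 5 - (recordP n : ℝ) / (recordQ n : ℝ)| < 1 / (q : ℝ) ^ γ :=
  record_exponent_of_table4_tail cwinsD16_holds bwinsD16_ok4 bwinsD16_chain hγ0 (by rw [bwinsD16_rate]; push_cast; nlinarith)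

end Summit.KontsevichZagierPeriods.Zeta5Search.RecordRay.BrickAtlas
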